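import Mathlib
import Summits.NavierStokesRegularity.NavierStokesRegularity.Theses.HalfHolderEnergy
import HarnessLib

/-!
# `HalfHolderEnergy.Assembly` — the route's assembly (item stmt-NavierStokesRegularity-25163;
  pure logic)

**Statement.** `EnergyHalfHolder → HolderBridge → NoLocalTypeISingularity → NavierStokesRegularity`.

PROOF. The route file `Theses/HalfHolderEnergy.lean` carries the planner-authored, kernel-checked
deciding theorem `Theses.HalfHolderEnergy.closes` with exactly these three hypotheses and this
conclusion (no finite-time blow-up ⇒ Clay (A) via `Theorems.navierStokesRegularity_of_noBlowup`;
at a hypothetical first blow-up time the window law and the bridge produce a local Type-I singular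
point, which `NoLocalTypeISingularity` denies). The assembly item is that implication written as
ONE proposition, so it is closed by applying `closes` to the hypotheses (the refuter's attached
candidate `Candidate25163.lean` is the same term).

HONEST FRAMING: glue between the route's own statements; two of the three hypotheses
(`EnergyHalfHolder`, `NoLocalTypeISingularity`) are OPEN cruxes and stay hypotheses. Nothing here
proves or refutes Navier–Stokes regularity.
-/

noncomputable section

set_option linter.dupNamespace false

namespace Summit.NavierStokesRegularity.NavierStokesRegularity.Theorems

open Summit.NavierStokesRegularity.NavierStokesRegularity.Theses.HalfHolderEnergy in
/-- **Item stmt-NavierStokesRegularity-25163** (`HalfHolderEnergy.Assembly`): the route's two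
cruxes and its bridge imply `NavierStokesRegularity`, by the route file's deciding theorem
`closes`. [this file] -/
theorem halfHolderEnergy_assembly_proof :
    Summit.NavierStokesRegularity.NavierStokesRegularity.Theses.HalfHolderEnergy.Assembly := by
  unfold Summit.NavierStokesRegularity.NavierStokesRegularity.Theses.HalfHolderEnergy.Assembly
  intro hH hB hL
  exact closes hH hB hL

end Summit.NavierStokesRegularity.NavierStokesRegularity.Theorems

end
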